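/-
Copyright: width seat `ym-line-sll-p4` (prover-ym-line-sll-p4-g0-0), route `SoftLoopLongLag`, crux K′ `SoftLoopLagFloorToTorus`
(stmt-QuantumFields-22504), line `birth` — plumbing for the E2 reduction (`…InnerMeanSmoothOfExpansionG`).
-/
import Summits.QuantumFields.YangMills.Theorems.SoftLoopLongLagBackgroundLoopFlux
import Summits.QuantumFields.YangMills.Theorems.SoftLoopLongLagSoftLoopLagFloorToTorusStubLimitPassageG
import Literature.MathematicalPhysics.QuantumLattice.CentreSymmetryConfinementProofs

/-!
# Route `SoftLoopLongLag`, crux K′ `SoftLoopLagFloorToTorus` (stmt-QuantumFields-22504), line `birth`: TRANSLATING SOFT LOOPS — the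
# translated / time-shifted soft-loop sum as a sum of rectangle Wilson loops, their means, and the size of the time-zero cube

Plumbing for the E2 reduction `innerDatumMeanSmoothG_of_loopMeanExpansion` (`Theorems/SoftLoopLongLagInnerMeanSmoothOfExpansionG.lean`) and for the
in-box mixture for means (K2 ⇐ E2): every compact `G`, any `LatticeRep`.

* `wilsonLoopObs_rectWalk_configShift` / `wilsonLoopObs_rectWalk_timeShiftLG` — rectangle Wilson loops are translation covariant:
  `W_{ℓ_x}(θ_v U) = W_{ℓ_{x−v}}(U)`, `W_{ℓ_x}(α_t U) = W_{ℓ_{x+te₀}}(U)` (tree `walkHolonomy_configShift_rectWalk`; `θ_v = configShift v`,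
  `α_t = timeShiftLG t = θ_{−te₀}`);
* `softLoopObs_configShift_neg` / `softLoopObs_configShift_neg_timeShiftLG` — `F_R(θ_{−c} U) = Σ_{z ∈ timeZeroCube R} W_{ℓ_{z+c}}(U)` and its
  time-shifted companion (the translated soft-loop observable `F_H = F_R ∘ θ_{−boxCentre H}` of the E-architecture, loop by loop);
* `integrable_wilsonLoopObs_rectWalk`, `integral_softLoopObs_configShift_neg(_timeShiftLG)` — the kernel mean of `F_H` (resp. `F_H ∘ α_t`)
  is the sum of the loop means;
* `integral_wilsonLoopObs_eq_cost` — loop mean vs loop COST mean: `N·∫W_ℓ = N − ∫(N − Re tr r(hol_ℓ))` (`N ≥ 1`, probability measure);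
* `sum_rectSurface_sCirc_eq_d₁` — on a spanning surface the `sCirc`-form and the `d₁ (·) p.1 1 2`-form of a flux sum agree;
* `card_timeZeroCube_le` (`≤ (2R+1)³`), `card_timeZeroCube_le_real` (`≤ 27R³`), `norm_le_of_mem_timeZeroCube`, `norm_loopBase_sub_le`
  (the loop base points `z + c + ie₀`, `i ≤ R`, stay within `2R` of `c`).

No new definition; standard axioms.  HONEST LABEL: rung R2xi-G RECORD label (leaf `WeakCouplingRates.XiPow`, an UPPER bound on the lattice mass
gap); NOT the Clay mass gap; no summit statement is touched.

References: H.-O. Georgii, *Gibbs Measures and Phase Transitions* (2011) §5.1 (5.3) (translations of configurations); E. Seiler, LNP 159 (1982)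
Ch. 2 (Wilson loops).
-/

set_option autoImplicit false

noncomputable section

open MeasureTheory Finset
open Literature.Probability.LatticeModels (Site box mem_box card_box)
open Literature.MathematicalPhysics.QuantumLattice
open Literature.MathematicalPhysics.QuantumFieldTheory
open Literature.MathematicalPhysics.QuantumFieldTheory.LatticeMaxwell
open Literature.MathematicalPhysics.QuantumFieldTheory.AxialGauge
open Literature.MathematicalPhysics.QuantumFieldTheory.LatticeChain
open Literature.MathematicalPhysics.QuantumFieldTheory.LatticeForm (d₁)
open Summit.QuantumFields.YangMills.Theorems.WeakCouplingRates

namespace Summit.QuantumFields.YangMills.Theorems.SoftLoopLongLag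

variable {G : Type} [Group G] [TopologicalSpace G] [IsTopologicalGroup G] [CompactSpace G]
  [MeasurableSpace G] [BorelSpace G]

/-! ## §1 Translating loops: `configShift`, `timeShiftLG` and the soft-loop sum -/

omit [TopologicalSpace G] [IsTopologicalGroup G] [CompactSpace G] [BorelSpace G] in
/-- Rectangle Wilson loops are translation covariant: `W_{ℓ_x}(θ_v U) = W_{ℓ_{x−v}}(U)` (`θ_v U (y,i) = U(y − v, i)`). -/
theorem wilsonLoopObs_rectWalk_configShift (χ : G → ℝ) (v x : Site 4) (i j : Fin 4) (R T : ℕ) (U : LGConfig 4 G) :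
    wilsonLoopObs χ (rectWalk x i j R T) (configShift v U) = wilsonLoopObs χ (rectWalk (x - v) i j R T) U := by
  unfold wilsonLoopObs
  have h := walkHolonomy_configShift_rectWalk v U (x - v) i j R T
  rw [sub_add_cancel] at h
  rw [h]

omit [TopologicalSpace G] [IsTopologicalGroup G] [CompactSpace G] [BorelSpace G] in
/-- Rectangle Wilson loops under the time shift: `W_{ℓ_x}(α_t U) = W_{ℓ_{x + t e₀}}(U)`. -/
theorem wilsonLoopObs_rectWalk_timeShiftLG (χ : G → ℝ) (t : ℕ) (x : Site 4) (i j : Fin 4) (R T : ℕ) (U : LGConfig 4 G) :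
    wilsonLoopObs χ (rectWalk x i j R T) (timeShiftLG (G := G) t U) =
      wilsonLoopObs χ (rectWalk (x + Pi.single 0 (t : ℤ)) i j R T) U := by
  change wilsonLoopObs χ (rectWalk x i j R T) (configShift (-(Pi.single 0 (t : ℤ))) U) = _
  rw [wilsonLoopObs_rectWalk_configShift, sub_neg_eq_add]

omit [IsTopologicalGroup G] [CompactSpace G] [BorelSpace G] in
/-- The soft-loop sum translated to `c`: `F_R(θ_{−c} U) = Σ_{z ∈ timeZeroCube R} W_{ℓ_{z + c}}(U)`. -/
theorem softLoopObs_configShift_neg (r : LatticeRep G) (R : ℕ) (c : Site 4) (U : LGConfig 4 G) :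
    softLoopObs r R (configShift (-c) U) = ∑ z ∈ timeZeroCube R,
      wilsonLoopObs (fun g : G => (r.N : ℝ)⁻¹ * (r.ρ g).trace.re) (rectWalk (z + c) 1 2 R R) U := by
  rw [softLoopObs_eq_sum]
  exact sum_congr rfl fun z _ => by rw [wilsonLoopObs_rectWalk_configShift, sub_neg_eq_add]

omit [IsTopologicalGroup G] [CompactSpace G] [BorelSpace G] in
/-- The time-shifted translated soft-loop sum: `F_R(θ_{−c}(α_t U)) = Σ_{z ∈ timeZeroCube R} W_{ℓ_{z + c + t e₀}}(U)`. -/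
theorem softLoopObs_configShift_neg_timeShiftLG (r : LatticeRep G) (R t : ℕ) (c : Site 4) (U : LGConfig 4 G) :
    softLoopObs r R (configShift (-c) (timeShiftLG (G := G) t U)) = ∑ z ∈ timeZeroCube R,
      wilsonLoopObs (fun g : G => (r.N : ℝ)⁻¹ * (r.ρ g).trace.re) (rectWalk (z + c + Pi.single 0 (t : ℤ)) 1 2 R R) U := by
  rw [softLoopObs_configShift_neg]
  exact sum_congr rfl fun z _ => wilsonLoopObs_rectWalk_timeShiftLG _ t _ 1 2 R R U

/-- One rectangle Wilson loop is integrable under a finite measure (bounded by `1`, continuous). -/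
theorem integrable_wilsonLoopObs_rectWalk [SecondCountableTopology G] (r : LatticeRep G) (x : Site 4) (R T : ℕ)
    (μ : Measure (LGConfig 4 G)) [IsFiniteMeasure μ] :
    Integrable (fun U => wilsonLoopObs (fun g : G => (r.N : ℝ)⁻¹ * (r.ρ g).trace.re) (rectWalk x 1 2 R T) U) μ :=
  Integrable.of_bound
    (continuous_wilsonLoopObs (continuous_normalisedCharacter_comp r.continuous) (rectWalk x 1 2 R T)).measurable.aestronglyMeasurable
    1 (ae_of_all _ fun U => by
      rw [Real.norm_eq_abs]; exact StringTension.abs_normalisedCharacter_le_one r.ρ r.continuous _)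

/-- **Mean of the translated soft-loop sum = sum of loop means**: `∫ F_R ∘ θ_{−c} dμ = Σ_{z ∈ timeZeroCube R} ∫ W_{ℓ_{z+c}} dμ`. -/
theorem integral_softLoopObs_configShift_neg [SecondCountableTopology G] (r : LatticeRep G) (R : ℕ) (c : Site 4)
    (μ : Measure (LGConfig 4 G)) [IsFiniteMeasure μ] :
    (∫ U, softLoopObs r R (configShift (-c) U) ∂μ) = ∑ z ∈ timeZeroCube R,
      ∫ U, wilsonLoopObs (fun g : G => (r.N : ℝ)⁻¹ * (r.ρ g).trace.re) (rectWalk (z + c) 1 2 R R) U ∂μ := by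
  simp_rw [softLoopObs_configShift_neg]
  exact integral_finsetSum _ fun z _ => integrable_wilsonLoopObs_rectWalk r (z + c) R R μ

/-- The time-shifted companion: `∫ F_R ∘ θ_{−c} ∘ α_t dμ = Σ_{z ∈ timeZeroCube R} ∫ W_{ℓ_{z+c+te₀}} dμ`. -/
theorem integral_softLoopObs_configShift_neg_timeShiftLG [SecondCountableTopology G] (r : LatticeRep G) (R t : ℕ) (c : Site 4)
    (μ : Measure (LGConfig 4 G)) [IsFiniteMeasure μ] :
    (∫ U, softLoopObs r R (configShift (-c) (timeShiftLG (G := G) t U)) ∂μ) = ∑ z ∈ timeZeroCube R,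
      ∫ U, wilsonLoopObs (fun g : G => (r.N : ℝ)⁻¹ * (r.ρ g).trace.re) (rectWalk (z + c + Pi.single 0 (t : ℤ)) 1 2 R R) U ∂μ := by
  simp_rw [softLoopObs_configShift_neg_timeShiftLG]
  exact integral_finsetSum _ fun z _ => integrable_wilsonLoopObs_rectWalk r _ R R μ

/-- **Loop mean vs loop COST mean** (`N ≥ 1`, probability measure): `N·∫ W_ℓ dμ = N − ∫ (N − Re tr r(hol_ℓ)) dμ`. -/
theorem integral_wilsonLoopObs_eq_cost [SecondCountableTopology G] (r : LatticeRep G) (hN : 0 < r.N) (x : Site 4) (R T : ℕ)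
    (μ : Measure (LGConfig 4 G)) [IsProbabilityMeasure μ] :
    (r.N : ℝ) * ∫ U, wilsonLoopObs (fun g : G => (r.N : ℝ)⁻¹ * (r.ρ g).trace.re) (rectWalk x 1 2 R T) U ∂μ =
      r.N - ∫ U, ((r.N : ℝ) - (r.ρ (walkHolonomy U (rectWalk x 1 2 R T))).trace.re) ∂μ := by
  have hNne : (r.N : ℝ) ≠ 0 := by exact_mod_cast hN.ne'
  have hpt : ∀ U, (r.N : ℝ) * wilsonLoopObs (fun g : G => (r.N : ℝ)⁻¹ * (r.ρ g).trace.re) (rectWalk x 1 2 R T) U =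
      r.N - ((r.N : ℝ) - (r.ρ (walkHolonomy U (rectWalk x 1 2 R T))).trace.re) := by
    intro U
    simp only [wilsonLoopObs]
    field_simp
    ring
  have hWi := integrable_wilsonLoopObs_rectWalk r x R T μ
  have hci : Integrable (fun U => ((r.N : ℝ) - (r.ρ (walkHolonomy U (rectWalk x 1 2 R T))).trace.re)) μ := by
    have heq : (fun U => ((r.N : ℝ) - (r.ρ (walkHolonomy U (rectWalk x 1 2 R T))).trace.re)) =
        fun U => (r.N : ℝ) - (r.N : ℝ) * wilsonLoopObs (fun g : G => (r.N : ℝ)⁻¹ * (r.ρ g).trace.re) (rectWalk x 1 2 R T) U := by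
      funext U; rw [hpt U]; ring
    rw [heq]
    exact (integrable_const _).sub (hWi.const_mul _)
  rw [← integral_const_mul]
  simp_rw [hpt]
  rw [integral_sub (integrable_const _) hci, integral_const, probReal_univ, one_smul]

/-- On the spanning surface every plaquette lies in the `(1,2)` plane: the `sCirc`-form of a surface sum is its `d₁ (·) (p.1) 1 2`-form. -/
theorem sum_rectSurface_sCirc_eq_d₁ (A : Literature.MathematicalPhysics.QuantumLattice.ZdEdge 4 → ℝ) (y : Site 4) (R T : ℕ) :
    ∑ p ∈ rectSurface y R T, sCirc A ((p.1, p.2.1.1, p.2.1.2) : Plaq 4) =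
      ∑ p ∈ rectSurface y R T, d₁ (fun w (i : Fin 4) => A (w, i)) p.1 1 2 := by
  rw [sum_rectSurface_eq, sum_rectSurface_eq]
  exact sum_congr rfl fun a _ => sum_congr rfl fun b _ => sCirc_eq_d₁ A _

/-! ## §2 The time-zero cube: size and position -/

/-- `#timeZeroCube R ≤ (2R+1)³` (the coordinate `x₀ = 0` is fixed; project to the three spatial coordinates). -/
theorem card_timeZeroCube_le (R : ℕ) : (timeZeroCube R).card ≤ (2 * R + 1) ^ 3 := by
  have hinj : Set.InjOn (fun x : Site 4 => fun k : Fin 3 => x k.succ) (timeZeroCube R) := by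
    intro x hx y hy hxy
    have hx0 : x 0 = 0 := (mem_filter.1 hx).2
    have hy0 : y 0 = 0 := (mem_filter.1 hy).2
    funext m
    refine Fin.cases ?_ (fun k => ?_) m
    · rw [hx0, hy0]
    · exact congr_fun hxy k
  have hmaps : Set.MapsTo (fun x : Site 4 => fun k : Fin 3 => x k.succ) (timeZeroCube R) (box 3 R) := by
    intro x hx
    have hxb : x ∈ box 4 R := (mem_filter.1 (Finset.mem_coe.1 hx)).1
    rw [mem_box] at hxb
    rw [Finset.mem_coe, mem_box]
    exact fun k => hxb k.succ
  calc (timeZeroCube R).card ≤ (box 3 R).card := card_le_card_of_injOn _ hmaps hinj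
    _ = (2 * R + 1) ^ 3 := card_box 3 R

/-- `#timeZeroCube R ≤ 27·R³` for `R ≥ 1`. -/
theorem card_timeZeroCube_le_real {R : ℕ} (hR : 1 ≤ R) : ((timeZeroCube R).card : ℝ) ≤ 27 * (R : ℝ) ^ 3 := by
  have h1 : ((timeZeroCube R).card : ℝ) ≤ ((2 * R + 1 : ℕ) : ℝ) ^ 3 := by exact_mod_cast card_timeZeroCube_le R
  have hR' : (1 : ℝ) ≤ R := by exact_mod_cast hR
  have h2 : ((2 * R + 1 : ℕ) : ℝ) ≤ 3 * R := by push_cast; linarith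
  calc ((timeZeroCube R).card : ℝ) ≤ ((2 * R + 1 : ℕ) : ℝ) ^ 3 := h1
    _ ≤ (3 * (R : ℝ)) ^ 3 := pow_le_pow_left₀ (by positivity) h2 3
    _ = 27 * (R : ℝ) ^ 3 := by ring

/-- Points of the time-zero cube lie within sup-distance `R` of the origin. -/
theorem norm_le_of_mem_timeZeroCube {R : ℕ} {z : Site 4} (hz : z ∈ timeZeroCube R) : ‖z‖ ≤ (R : ℝ) := by
  have hzb : z ∈ box 4 R := (mem_filter.1 hz).1
  rw [mem_box] at hzb
  refine (pi_norm_le_iff_of_nonneg (by positivity)).2 fun m => ?_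
  rw [Int.norm_eq_abs]
  obtain ⟨h1, h2⟩ := hzb m
  have h1' : (-(R : ℝ)) ≤ ((z m : ℤ) : ℝ) := by exact_mod_cast h1
  have h2' : ((z m : ℤ) : ℝ) ≤ R := by exact_mod_cast h2
  exact abs_le.2 ⟨h1', h2'⟩

/-- The loop base points `z + c + i e₀`, `z ∈ timeZeroCube R`, `i ≤ R`, are within `2R` of `c`. -/
theorem norm_loopBase_sub_le {R : ℕ} {z : Site 4} (hz : z ∈ timeZeroCube R) (c : Site 4) {i : ℕ} (hi : i ≤ R) :
    ‖z + c + Pi.single 0 (i : ℤ) - c‖ ≤ 2 * (R : ℝ) := by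
  have hsplit : z + c + Pi.single 0 (i : ℤ) - c = z + Pi.single 0 (i : ℤ) := by
    funext m; simp only [Pi.add_apply, Pi.sub_apply]; ring
  rw [hsplit]
  have hsingle : ‖(Pi.single 0 (i : ℤ) : Site 4)‖ ≤ (R : ℝ) := by
    refine (pi_norm_le_iff_of_nonneg (by positivity)).2 fun m => ?_
    simp only [Pi.single_apply]
    split_ifs
    · rw [Int.norm_eq_abs, Int.cast_natCast, Nat.abs_cast]; exact_mod_cast hi
    · rw [norm_zero]; positivity
  linarith [norm_add_le z (Pi.single 0 (i : ℤ) : Site 4), norm_le_of_mem_timeZeroCube hz]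

end Summit.QuantumFields.YangMills.Theorems.SoftLoopLongLag

end
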